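import Literature.NumberTheory.GaloisRepresentations.MaxUnramifiedIntegers
import Literature.NumberTheory.GaloisRepresentations.AbsGaloisGroupCompact
import Mathlib.Topology.Compactness.Compact
import HarnessLib

/-!
# Frobenius powers are dense in `Gal(F̄/F)` modulo inertia: agreement on `F(μ_M)` and cofinality

Let `F` be a non-archimedean local field, `q = #𝓀[F]`, `Γ_F = Gal(F̄/F)`, `I_F = absInertia F`,
`σ₀` an arithmetic Frobenius.  `Gal(F_nr/F) = Γ_F / I_F` is pro-cyclic, topologically generated
by `σ₀` (Serre, *Local Fields*, Ch. IV §4, Cor. 2: `Gal(K_nr/K) = Ẑ`); this file proves the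
two concrete consequences used to pass from Frobenius-invariance to Galois-invariance:

* `exists_smul_rootOfUnity_eq_pow` — **every `σ ∈ Γ_F` acts on the roots of unity of order
  `M` prime to `p` as `ζ ↦ ζ ^ (q ^ a)`** for some `a` (i.e. `Gal(F(ζ_M)/F)` is generated by
  Frobenius).  Elementary proof through the residue field: the minimal-polynomial-free identity
  `∏_{i<d} (X - ζ̄^{qⁱ}) ∈ k[X]` (its coefficients are Frobenius-fixed, hence in `k`,
  `mem_range_algebraMap_of_pow_residueFieldCard_eq`) forces `σ̄ ζ̄ = ζ̄^{qᵃ}`, and roots of unity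
  of order prime to `p` are distinct modulo `𝔓`;
* `exists_forall_mem_adjoin_rootsOfUnity_smul_eq` — hence **on each `F(μ_M)` every `σ` agrees
  with a power `σ₀ ^ a` of an arithmetic Frobenius**, and every finite subset of `F_nr` lies in
  some `F(μ_M)` (`exists_subset_adjoin_rootsOfUnity`);
* `exists_fixing_rootsOfUnity_subset` — **cofinality**: every open `U ⊆ Γ_F` containing `I_F`
  contains the pointwise fixator of `μ_M` for some `M` prime to `p` (compactness of `Γ_F`:
  `I_F = ⋂_M Fix(μ_M)`, a directed intersection of closed sets, `mem_absInertia_iff_smul_rootsOfUnity`).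

Consequence (`exists_forall_smul_eq_pow_and_mem`): for `σ ∈ Γ_F`, a finite `T ⊆ F_nr` and an
open `U ⊇ I_F` there is `a` with `σ = σ₀ ^ a` on `T` and `(σ₀ ^ a)⁻¹ σ ∈ U`.  No definitions, no
named facts.

## References

* [SerreLocalFields1979] J.-P. Serre, *Local Fields*, GTM 67, Ch. IV §4 Prop. 16, Cor. 1–2.
* [NeukirchANT1999] J. Neukirch, *Algebraic Number Theory*, Ch. II (7.12)–(7.13), Ch. IV (1.2).
-/

noncomputable section

open ValuativeRel Field Polynomial
open scoped Pointwise IntermediateField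

namespace Literature.NumberTheory.GaloisRepresentations
namespace IsNonarchimedeanLocalField

variable {F : Type*} [Field F] [ValuativeRel F] [TopologicalSpace F] [IsNonarchimedeanLocalField F]

/-! ### Roots of unity of order prime to `p`: the action is through powers of `q` -/

section ResidueField

attribute [local instance] Ideal.Quotient.field

/-- The `q`-power map of `k̄ = S ⧸ 𝔓` is a ring homomorphism (`q = p'^f`, `p' = char k̄`).
[folklore] -/
theorem exists_ringHom_apply_eq_pow_residueFieldCard (F : Type*) [Field F] [ValuativeRel F]
    [TopologicalSpace F] [IsNonarchimedeanLocalField F] :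
    ∃ τ : (absIntegers 𝒪[F] F ⧸ absMaximalIdeal F) →+* (absIntegers 𝒪[F] F ⧸ absMaximalIdeal F),
      ∀ y, τ y = y ^ residueFieldCard F := by
  set k' := absIntegers 𝒪[F] F ⧸ absMaximalIdeal F
  obtain ⟨f, -, hf⟩ := residueFieldCard_eq_pow_ringChar F
  set p' := ringChar 𝓀[F] with hp'
  haveI : Fact p'.Prime := ⟨CharP.char_is_prime 𝓀[F] p'⟩
  haveI : CharP k' p' := charP_of_injective_algebraMap (algebraMap 𝓀[F] k').injective p'
  refine ⟨iterateFrobenius k' p' f, fun y => ?_⟩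
  rw [iterateFrobenius_def, hf]

/-- **`σ ∈ Gal(F̄/F)` acts on `μ_M` (`M` prime to `p`) as `ζ ↦ ζ ^ (q ^ a)` for some `a`**
(`Gal(F(ζ_M)/F)` is generated by the Frobenius; Serre, *Local Fields*, Ch. IV §4, Prop. 16:
`Gal(K_n/K) ≅ Gal(k_n/k)` generated by `x ↦ x^q`).  Proof through `k̄ = S ⧸ 𝔓`: for a primitive
`ζ`, the polynomial `∏_{i<d} (X - ζ̄^{qⁱ})` (`ζ̄^{q^d} = ζ̄`) has Frobenius-fixed coefficients, so
lies in `k[X]`, and `σ̄ ζ̄` is one of its roots; roots of unity of order prime to `p` are distinct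
modulo `𝔓`. [cite: SerreLocalFields1979, Ch. IV §4 Prop. 16] -/
theorem exists_smul_rootOfUnity_eq_pow (σ : absoluteGaloisGroup F) {M : ℕ} (hM : IsUnit ((M : ℕ) : 𝒪[F])) :
    ∃ a : ℕ, ∀ ζ : AlgebraicClosure F, ζ ^ M = 1 → σ • ζ = ζ ^ residueFieldCard F ^ a := by
  classical
  set q := residueFieldCard F with hq
  set S := absIntegers 𝒪[F] F
  set P := absMaximalIdeal F
  set k' := S ⧸ P
  have hM0 : M ≠ 0 := by rintro rfl; simp at hM
  haveI : NeZero ((M : ℕ) : AlgebraicClosure F) := ⟨by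
    have hu := hM.map (algebraMap 𝒪[F] (AlgebraicClosure F))
    rw [map_natCast] at hu
    exact hu.ne_zero⟩
  obtain ⟨ζ₀, hζ₀⟩ := HasEnoughRootsOfUnity.exists_primitiveRoot (AlgebraicClosure F) M
  have hζ₀i : IsIntegral 𝒪[F] ζ₀ :=
    IsIntegral.of_pow (Nat.pos_of_ne_zero hM0) (by rw [hζ₀.pow_eq_one]; exact isIntegral_one)
  set Z₀ : S := ⟨ζ₀, hζ₀i⟩ with hZ₀
  -- the Frobenius `τ = (·)^q` of `k̄`, and the residue `x` of `ζ₀`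
  obtain ⟨τ, hτ⟩ := exists_ringHom_apply_eq_pow_residueFieldCard F
  set mk := Ideal.Quotient.mk P with hmk
  set x : k' := mk Z₀ with hx
  -- `σ` induces `σ̄` on `k̄`, fixing `k`
  have hPσ : P ≤ P.comap (MulSemiringAction.toRingHom _ S σ) := by
    intro b hb
    rw [Ideal.mem_comap]
    have : σ • b ∈ σ • P := Ideal.smul_mem_pointwise_smul _ _ _ hb
    rwa [smul_absMaximalIdeal_holds F] at this
  set σbar : k' →+* k' := Ideal.quotientMap P (MulSemiringAction.toRingHom _ S σ) hPσ with hσbar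
  have hσbar_mk : ∀ b : S, σbar (mk b) = mk (σ • b) := fun b => Ideal.quotientMap_mk
  have hσbar_alg : σbar.comp (algebraMap 𝓀[F] k') = algebraMap 𝓀[F] k' := by
    refine RingHom.ext fun r => ?_
    obtain ⟨a, rfl⟩ := IsLocalRing.residue_surjective r
    rw [RingHom.comp_apply, algebraMap_residue, ← hmk, hσbar_mk]
    congr 1
    refine Subtype.ext ?_
    rw [integralClosure.coe_smul]
    change σ • algebraMap 𝒪[F] (AlgebraicClosure F) a = algebraMap 𝒪[F] (AlgebraicClosure F) a
    rw [IsScalarTower.algebraMap_apply 𝒪[F] F (AlgebraicClosure F), absoluteGaloisGroup.smul_def,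
      AlgEquiv.commutes]
  -- a period `d > 0` with `x ^ (q ^ d) = x`
  obtain ⟨d, hd, hxd⟩ := exists_pow_residueFieldCard_pow_sub_mem Z₀
  have hxd' : x ^ q ^ d = x := by
    rw [hx, ← map_pow, Ideal.Quotient.eq]
    exact hxd
  have hτi : ∀ i : ℕ, ∀ y : k', (τ^[i]) y = y ^ q ^ i := by
    intro i
    induction i with
    | zero => intro y; simp
    | succ i ih => intro y; rw [Function.iterate_succ_apply', ih, hτ, ← pow_mul, ← pow_succ]
  -- the polynomial `Q = ∏_{i<d} (X - x^{q^i})` is `τ`-invariant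
  set Q : k'[X] := ∏ i ∈ Finset.range d, (X - C (x ^ q ^ i)) with hQ
  have hQmap : Q.map τ = Q := by
    rw [hQ, Polynomial.map_prod]
    simp only [Polynomial.map_sub, Polynomial.map_X, Polynomial.map_C, hτ, ← pow_mul]
    -- reindex: `∏_{i<d} f (i+1) = ∏_{i<d} f i` using `f d = f 0`
    set f : ℕ → k'[X] := fun i => X - C (x ^ q ^ i) with hf
    change ∏ i ∈ Finset.range d, f (i + 1) = ∏ i ∈ Finset.range d, f i
    have h1 : (∏ i ∈ Finset.range d, f (i + 1)) * f 0 = (∏ i ∈ Finset.range d, f i) * f d := by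
      rw [← Finset.prod_range_succ, Finset.prod_range_succ']
    have hfd : f d = f 0 := by simp only [hf, pow_zero, pow_one, hxd']
    rw [hfd] at h1
    have hf0 : f 0 ≠ 0 := by simp only [hf, pow_zero, pow_one]; exact X_sub_C_ne_zero x
    exact mul_right_cancel₀ hf0 h1
  -- hence `Q` has coefficients in `k`
  have hQlifts : Q ∈ Polynomial.lifts (algebraMap 𝓀[F] k') := by
    rw [Polynomial.lifts_iff_coeff_lifts]
    intro n
    have hc : (Q.coeff n) ^ q = Q.coeff n := by
      have := congrArg (fun R : k'[X] => R.coeff n) hQmap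
      simp only [Polynomial.coeff_map, hτ] at this
      exact this
    exact mem_range_algebraMap_of_pow_residueFieldCard_eq hc
  obtain ⟨Q₀, hQ₀⟩ := (Polynomial.mem_lifts _).1 hQlifts
  -- `σ̄ x` is a root of `Q`
  have hQx : Q.eval x = 0 := by
    rw [hQ, Polynomial.eval_prod, Finset.prod_eq_zero_iff]
    exact ⟨0, Finset.mem_range.2 hd, by simp⟩
  have hQσx : Q.eval (σbar x) = 0 := by
    have h1 : σbar (Q.eval x) = Q.eval (σbar x) := by
      rw [← hQ₀, Polynomial.eval_map, Polynomial.hom_eval₂, hσbar_alg, Polynomial.eval_map]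
    rw [← h1, hQx, map_zero]
  rw [hQ, Polynomial.eval_prod, Finset.prod_eq_zero_iff] at hQσx
  obtain ⟨a, -, ha⟩ := hQσx
  simp only [Polynomial.eval_sub, Polynomial.eval_X, Polynomial.eval_C, sub_eq_zero] at ha
  -- lift to `F̄`: `σ ζ₀ ≡ ζ₀ ^ (q ^ a)` and both are `M`-th roots of unity
  refine ⟨a, fun ζ hζ => ?_⟩
  have hσζ₀ : σ • ζ₀ = ζ₀ ^ q ^ a := by
    have hmem : σ • Z₀ - Z₀ ^ q ^ a ∈ P := by
      rw [← Ideal.Quotient.eq, ← hmk, ← hσbar_mk, map_pow]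
      exact ha
    have hlt : algNorm F (σ • ζ₀ - ζ₀ ^ q ^ a) < 1 := by
      rw [mem_absMaximalIdeal_iff_algNorm_lt_one] at hmem
      exact hmem
    have hζ₀0 : ζ₀ ≠ 0 := by
      intro h
      have := hζ₀.pow_eq_one
      rw [h, zero_pow hM0] at this
      exact zero_ne_one this
    have hpow0 : ζ₀ ^ q ^ a ≠ 0 := pow_ne_zero _ hζ₀0
    set η := σ • ζ₀ / ζ₀ ^ q ^ a with hη
    have hηM : η ^ M = 1 := by
      rw [hη, div_pow, ← smul_pow', ← pow_mul, mul_comm, pow_mul, hζ₀.pow_eq_one, smul_one, one_pow,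
        div_one]
    have hnorm1 : algNorm F (ζ₀ ^ q ^ a) = 1 := by
      rw [algNorm_pow]
      have := algNorm_eq_one_of_pow_eq_one (F := F) hM0 hζ₀.pow_eq_one
      rw [this, one_pow]
    have hη1 : algNorm F (η - 1) < 1 := by
      have : η - 1 = (σ • ζ₀ - ζ₀ ^ q ^ a) / ζ₀ ^ q ^ a := by
        rw [hη, sub_div, div_self hpow0]
      rw [this, algNorm_div, hnorm1, div_one]
      exact hlt
    have := eq_one_of_pow_eq_one_of_algNorm_sub_one_lt_one hM hηM hη1
    rw [hη, div_eq_one_iff_eq hpow0] at this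
    exact this
  haveI : NeZero M := ⟨hM0⟩
  obtain ⟨i, -, rfl⟩ := hζ₀.eq_pow_of_pow_eq_one hζ
  rw [smul_pow', hσζ₀, ← pow_mul, ← pow_mul, mul_comm]

end ResidueField

/-! ### Agreement with Frobenius powers on `F(μ_M)` -/

/-- An arithmetic Frobenius acts on `μ_M` (`M` prime to `p`) as `ζ ↦ ζ ^ q`, hence `σ₀ ^ a` as
`ζ ↦ ζ ^ (q ^ a)`. [cite: SerreLocalFields1979, Ch. IV §4 Prop. 16] -/
theorem IsAbsArithFrob.pow_smul_rootOfUnity {σ₀ : absoluteGaloisGroup F} (hσ₀ : IsAbsArithFrob σ₀)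
    {M : ℕ} (hM : IsUnit ((M : ℕ) : 𝒪[F])) (a : ℕ) {ζ : AlgebraicClosure F} (hζ : ζ ^ M = 1) :
    σ₀ ^ a • ζ = ζ ^ residueFieldCard F ^ a := by
  have hM0 : M ≠ 0 := by rintro rfl; simp at hM
  -- `σ₀ ζ = ζ ^ q`: congruent modulo `𝔓`, both roots of unity of order prime to `p`
  have hone : ∀ {ξ : AlgebraicClosure F}, ξ ^ M = 1 → σ₀ • ξ = ξ ^ residueFieldCard F := by
    intro ξ hξ
    have hξi : IsIntegral 𝒪[F] ξ :=
      IsIntegral.of_pow (Nat.pos_of_ne_zero hM0) (by rw [hξ]; exact isIntegral_one)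
    have hmem := isAbsArithFrob_iff_holds.1 hσ₀ ⟨ξ, hξi⟩
    rw [mem_absMaximalIdeal_iff_algNorm_lt_one] at hmem
    change algNorm F (σ₀ • ξ - ξ ^ residueFieldCard F) < 1 at hmem
    have hξ0 : ξ ≠ 0 := by rintro rfl; rw [zero_pow hM0] at hξ; exact zero_ne_one hξ
    have hpow0 : ξ ^ residueFieldCard F ≠ 0 := pow_ne_zero _ hξ0
    have hηM : (σ₀ • ξ / ξ ^ residueFieldCard F) ^ M = 1 := by
      rw [div_pow, ← smul_pow', ← pow_mul, mul_comm, pow_mul, hξ, smul_one, one_pow, div_one]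
    have hnorm1 : algNorm F (ξ ^ residueFieldCard F) = 1 := by
      rw [algNorm_pow, algNorm_eq_one_of_pow_eq_one (F := F) hM0 hξ, one_pow]
    have hη1 : algNorm F (σ₀ • ξ / ξ ^ residueFieldCard F - 1) < 1 := by
      rw [show σ₀ • ξ / ξ ^ residueFieldCard F - 1 = (σ₀ • ξ - ξ ^ residueFieldCard F) / ξ ^ residueFieldCard F
        by rw [sub_div, div_self hpow0], algNorm_div, hnorm1, div_one]
      exact hmem
    have := eq_one_of_pow_eq_one_of_algNorm_sub_one_lt_one hM hηM hη1
    rwa [div_eq_one_iff_eq hpow0] at this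
  induction a with
  | zero => rw [pow_zero, one_smul, pow_zero, pow_one]
  | succ a ih =>
    rw [pow_succ, mul_smul, hone hζ, smul_pow', ih, ← pow_mul, ← pow_succ]

omit [ValuativeRel F] [TopologicalSpace F] [IsNonarchimedeanLocalField F] in
/-- `σ` and `τ` agree on `F(μ_M)` as soon as they agree on `μ_M`. [folklore] -/
theorem smul_eq_smul_of_mem_adjoin_rootsOfUnity {σ τ : absoluteGaloisGroup F} {M : ℕ}
    (h : ∀ ζ : AlgebraicClosure F, ζ ^ M = 1 → σ • ζ = τ • ζ) {x : AlgebraicClosure F}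
    (hx : x ∈ IntermediateField.adjoin F {ζ : AlgebraicClosure F | ζ ^ M = 1}) : σ • x = τ • x := by
  refine IntermediateField.adjoin_induction (F := F) (s := {ζ : AlgebraicClosure F | ζ ^ M = 1})
    (p := fun y _ => σ • y = τ • y) ?_ ?_ ?_ ?_ ?_ hx
  · intro y hy; exact h y hy
  · intro y
    rw [absoluteGaloisGroup.smul_def, absoluteGaloisGroup.smul_def, AlgEquiv.commutes, AlgEquiv.commutes]
  · intro y w _ _ hy hw; rw [smul_add, smul_add, hy, hw]
  · intro y _ hy; rw [smul_inv'', smul_inv'', hy]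
  · intro y w _ _ hy hw; rw [smul_mul', smul_mul', hy, hw]

/-- **On `F(μ_M)` every `σ ∈ Gal(F̄/F)` agrees with a power of an arithmetic Frobenius.**
[cite: SerreLocalFields1979, Ch. IV §4 Prop. 16] -/
theorem exists_forall_mem_adjoin_rootsOfUnity_smul_eq {σ₀ : absoluteGaloisGroup F}
    (hσ₀ : IsAbsArithFrob σ₀) (σ : absoluteGaloisGroup F) {M : ℕ} (hM : IsUnit ((M : ℕ) : 𝒪[F])) :
    ∃ a : ℕ, ∀ x ∈ IntermediateField.adjoin F {ζ : AlgebraicClosure F | ζ ^ M = 1},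
      σ • x = σ₀ ^ a • x := by
  obtain ⟨a, ha⟩ := exists_smul_rootOfUnity_eq_pow σ hM
  exact ⟨a, fun x hx => smul_eq_smul_of_mem_adjoin_rootsOfUnity
    (fun ζ hζ => by rw [ha ζ hζ, IsAbsArithFrob.pow_smul_rootOfUnity hσ₀ hM a hζ]) hx⟩

omit [TopologicalSpace F] [IsNonarchimedeanLocalField F] in
/-- **Every finite subset of `F_nr = F(μ_{p'})` lies in some `F(μ_M)`**, `M` prime to `p`.
[cite: SerreLocalFields1979, Ch. IV §4 Cor. 2 to Prop. 16] -/
theorem exists_subset_adjoin_rootsOfUnity (T : Finset (AlgebraicClosure F))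
    (hT : ∀ t ∈ T, t ∈ maxUnramified F) :
    ∃ M : ℕ, IsUnit ((M : ℕ) : 𝒪[F]) ∧
      ∀ t ∈ T, t ∈ IntermediateField.adjoin F {ζ : AlgebraicClosure F | ζ ^ M = 1} := by
  classical
  -- each `t` lies in `F(T_t)` for a finite set `T_t` of roots of unity of orders prime to `p`
  have h1 : ∀ t ∈ T, ∃ M : ℕ, IsUnit ((M : ℕ) : 𝒪[F]) ∧
      t ∈ IntermediateField.adjoin F {ζ : AlgebraicClosure F | ζ ^ M = 1} := by
    intro t ht
    obtain ⟨T', hT', htT'⟩ := IntermediateField.exists_finset_of_mem_adjoin (hT t ht)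
    choose Nt hNtu hNt using fun s : T' => hT' s.2
    refine ⟨∏ s : T', Nt s, ?_, ?_⟩
    · rw [Nat.cast_prod]
      exact Finset.prod_induction _ IsUnit (fun a b ha hb => ha.mul hb) isUnit_one (fun s _ => hNtu s)
    · refine IntermediateField.adjoin.mono F _ _ ?_ htT'
      intro s hs
      obtain ⟨m, hm⟩ : Nt ⟨s, hs⟩ ∣ ∏ s : T', Nt s := Finset.dvd_prod_of_mem _ (Finset.mem_univ _)
      show s ^ (∏ s : T', Nt s) = 1
      rw [hm, pow_mul, hNt ⟨s, hs⟩, one_pow]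
  choose! Mt hMtu hMt using h1
  refine ⟨∏ t ∈ T, Mt t, ?_, fun t ht => ?_⟩
  · rw [Nat.cast_prod]
    exact Finset.prod_induction _ IsUnit (fun a b ha hb => ha.mul hb) isUnit_one (fun t ht => hMtu t ht)
  · refine IntermediateField.adjoin.mono F _ _ ?_ (hMt t ht)
    intro s hs
    obtain ⟨m, hm⟩ : Mt t ∣ ∏ t ∈ T, Mt t := Finset.dvd_prod_of_mem _ ht
    show s ^ (∏ t ∈ T, Mt t) = 1
    rw [hm, pow_mul, show s ^ Mt t = 1 from hs, one_pow]

/-! ### Cofinality: open subgroups containing inertia contain a fixator of `μ_M` -/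

omit [ValuativeRel F] [TopologicalSpace F] [IsNonarchimedeanLocalField F] in
/-- The pointwise fixator of `μ_M` in `Gal(F̄/F)` is closed (stabilisers of algebraic elements
are open). [folklore] -/
theorem isClosed_setOf_forall_smul_rootOfUnity (M : ℕ) :
    IsClosed {σ : absoluteGaloisGroup F | ∀ ζ : AlgebraicClosure F, ζ ^ M = 1 → σ • ζ = ζ} := by
  have : {σ : absoluteGaloisGroup F | ∀ ζ : AlgebraicClosure F, ζ ^ M = 1 → σ • ζ = ζ} =
      ⋂ ζ ∈ {ζ : AlgebraicClosure F | ζ ^ M = 1}, {σ : absoluteGaloisGroup F | σ • ζ ∈ ({ζ} : Set _)} := by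
    ext σ; simp
  rw [this]
  refine isClosed_biInter fun ζ _ => ?_
  exact isClosed_setOf_smul_mem_of_isOpen_stabilizer ζ
    (stabilizer_isOpen_of_isIntegral (K := F) ζ) {ζ}

/-- **Cofinality of the fixators of `μ_M` among open neighbourhoods of the inertia group**: every
open `U ⊆ Gal(F̄/F)` containing `I_F` contains `{σ | σ ζ = ζ for all ζ ∈ μ_M}` for some `M`
prime to `p`.  (`I_F = ⋂_M Fix(μ_M)` by `mem_absInertia_iff_smul_rootsOfUnity`, a directed
intersection of closed sets in the compact group `Gal(F̄/F)`.)
[cite: SerreLocalFields1979, Ch. IV §4 Cor. 2 to Prop. 16] -/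
theorem exists_fixing_rootsOfUnity_subset {U : Set (absoluteGaloisGroup F)} (hU : IsOpen U)
    (hIU : (absInertia F : Set (absoluteGaloisGroup F)) ⊆ U) :
    ∃ M : ℕ, IsUnit ((M : ℕ) : 𝒪[F]) ∧
      {σ : absoluteGaloisGroup F | ∀ ζ : AlgebraicClosure F, ζ ^ M = 1 → σ • ζ = ζ} ⊆ U := by
  haveI : CompactSpace (absoluteGaloisGroup F) := absoluteGaloisGroup_compactSpace F
  let ι := {M : ℕ // IsUnit ((M : ℕ) : 𝒪[F])}
  haveI : Nonempty ι := ⟨⟨1, by simp⟩⟩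
  let Z : ι → Set (absoluteGaloisGroup F) := fun M =>
    {σ | ∀ ζ : AlgebraicClosure F, ζ ^ (M : ℕ) = 1 → σ • ζ = ζ}
  have hZc : ∀ M, IsClosed (Z M) := fun M => isClosed_setOf_forall_smul_rootOfUnity (F := F) M
  have hZI : (⋂ M, Z M) = (absInertia F : Set (absoluteGaloisGroup F)) := by
    ext σ
    simp only [Set.mem_iInter, SetLike.mem_coe, mem_absInertia_iff_smul_rootsOfUnity]
    exact ⟨fun h N hN ζ hζ => h ⟨N, hN⟩ ζ hζ, fun h M ζ hζ => h M M.2 ζ hζ⟩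
  have hdir : Directed (· ⊇ ·) Z := by
    intro M₁ M₂
    refine ⟨⟨M₁ * M₂, by rw [Nat.cast_mul]; exact M₁.2.mul M₂.2⟩, ?_, ?_⟩
    · intro σ hσ ζ hζ
      exact hσ ζ (show ζ ^ ((M₁ : ℕ) * (M₂ : ℕ)) = 1 by rw [pow_mul, hζ, one_pow])
    · intro σ hσ ζ hζ
      exact hσ ζ (show ζ ^ ((M₁ : ℕ) * (M₂ : ℕ)) = 1 by rw [mul_comm, pow_mul, hζ, one_pow])
  have hs : IsCompact Uᶜ := hU.isClosed_compl.isCompact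
  have hsZ : Uᶜ ∩ ⋂ M, Z M = ∅ := by
    rw [hZI, Set.eq_empty_iff_forall_notMem]
    rintro σ ⟨hσU, hσI⟩
    exact hσU (hIU hσI)
  obtain ⟨M, hM⟩ := hs.elim_directed_family_closed Z hZc hsZ hdir
  refine ⟨M, M.2, fun σ hσ => ?_⟩
  by_contra hσU
  have : σ ∈ Uᶜ ∩ Z M := ⟨hσU, hσ⟩
  rw [hM] at this
  exact this

/-- **Frobenius powers approximate every `σ`**: for `σ ∈ Gal(F̄/F)`, an arithmetic Frobenius `σ₀`,
a finite `T ⊆ F_nr` and an open `U ⊇ I_F` there is `a : ℕ` with `σ t = σ₀ ^ a t` for `t ∈ T` and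
`(σ₀ ^ a)⁻¹ σ ∈ U` (density of `⟨σ₀⟩ I_F` in `Gal(F̄/F)`; Serre, *Local Fields*, Ch. IV §4 Cor. 2:
`Gal(K_nr/K) = Ẑ`). [cite: SerreLocalFields1979, Ch. IV §4 Cor. 2 to Prop. 16] -/
theorem exists_forall_smul_eq_pow_and_mem {σ₀ : absoluteGaloisGroup F} (hσ₀ : IsAbsArithFrob σ₀)
    (σ : absoluteGaloisGroup F) (T : Finset (AlgebraicClosure F)) (hT : ∀ t ∈ T, t ∈ maxUnramified F)
    {U : Set (absoluteGaloisGroup F)} (hU : IsOpen U)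
    (hIU : (absInertia F : Set (absoluteGaloisGroup F)) ⊆ U) :
    ∃ a : ℕ, (∀ t ∈ T, σ • t = σ₀ ^ a • t) ∧ (σ₀ ^ a)⁻¹ * σ ∈ U := by
  obtain ⟨M₁, hM₁, hT₁⟩ := exists_subset_adjoin_rootsOfUnity T hT
  obtain ⟨M₂, hM₂, hU₂⟩ := exists_fixing_rootsOfUnity_subset hU hIU
  have hM : IsUnit (((M₁ * M₂ : ℕ) : ℕ) : 𝒪[F]) := by rw [Nat.cast_mul]; exact hM₁.mul hM₂
  obtain ⟨a, ha⟩ := exists_smul_rootOfUnity_eq_pow σ hM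
  refine ⟨a, fun t ht => ?_, hU₂ fun ζ hζ => ?_⟩
  · refine smul_eq_smul_of_mem_adjoin_rootsOfUnity (M := M₁) (fun ζ hζ => ?_) (hT₁ t ht)
    have hζ' : ζ ^ (M₁ * M₂) = 1 := by rw [pow_mul, hζ, one_pow]
    rw [ha ζ hζ', IsAbsArithFrob.pow_smul_rootOfUnity hσ₀ hM a hζ']
  · have hζ' : ζ ^ (M₁ * M₂) = 1 := by rw [mul_comm, pow_mul, hζ, one_pow]
    rw [mul_smul, ha ζ hζ', ← IsAbsArithFrob.pow_smul_rootOfUnity hσ₀ hM a hζ', inv_smul_smul]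

end IsNonarchimedeanLocalField
end Literature.NumberTheory.GaloisRepresentations

end
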